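import Mathlib

/-!
# BalabanIR engine `BirComplexStableXYR` (stmt-HubbardSuperconductivity-14845) / reduction
# `BirGappedPhaseReductionR` (stmt-HubbardSuperconductivity-14846): traces of even powers of a
# pseudo-Hermitian transfer matrix with a REFLECTION-POSITIVE Hermitian part are positive

Support file (`--supports stmt-HubbardSuperconductivity-14846`, line lead pass c7).  Context.  As typed,
`BirGappedPhaseReductionR ↔ (BirComplexStableXYR → BirGroundStateAverageLRO)` (crux 3 is proved), and the only
target-free closer is `¬ BirComplexStableXYR`; by the landed hidden-positivity files the first conjunct of the
engine is equivalent to `0 < Re Z` for every admissible table.  For windows of temporal range `r ≥ 3` the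
multi-slice transfer operator of an admissible table is only PSEUDO-Hermitian,
`T* = S T S` with `S` the unitary involution reversing the internal slice order
(`Theorems.birMulti_block_pseudoHerm`), and "no positivity follows" was the recorded state.

This file records, as finite-dimensional linear algebra (discretised angles; no analysis), exactly WHAT
positivity does follow and from WHICH extra hypothesis:

* `birKrein_isHermitian_mul` — `S* = S`, `S² = 1`, `T* = S T S` ⇒ `H := S T` is Hermitian (so `T = S H` is
  self-adjoint for the indefinite form `⟨S·,·⟩`: a Krein-space self-adjoint operator).
* `birKrein_trace_pow_eq` — for any factor `R`, `tr (S (Rᴴ R))^(k+1) = tr (R S Rᴴ)^(k+1)` (cyclicity), and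
  `R S Rᴴ` is Hermitian.
* `birKrein_trace_even_pow_nonneg` — if moreover `H = S T` is POSITIVE SEMIDEFINITE (for the one-slice-shift
  transfer matrix this is reflection positivity of the `r`-slice weight through its middle `r-2` slices, for each
  fixed middle configuration) then `tr T^(2m)` is real and `≥ 0` for every `m`:
  `tr T^(2m) = tr (H^{1/2} S H^{1/2})^(2m) = ‖(H^{1/2} S H^{1/2})^m‖²_HS`.
* `birKrein_trace_even_pow_pos` — if `H = S T` is positive DEFINITE then `tr T^(2m) > 0`.

Reading for the cruxes.  Inside the time-reflection class (R) the partition function at even temporal extent is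
`Z = tr T^(2m)`; the theorems say that a sign change of `Z` (the only way to refute conjunct 1, an open
condition) is impossible on the reflection-positive SUBCLASS `S T ⪰ 0` for EVERY range `r` — the `r = 2` case
(`S = 1`, `T` Hermitian) is the landed `birEven_partitionFunction_pos` — and that outside it a sign change at
large even `M` needs a non-real eigenvalue of maximal modulus, i.e. a Krein collision between eigenvalues of
opposite `S`-type at the top of the spectrum.  The subclass contains the all-pairs real XY table (its
first-to-last-slice coupling matrix is the autocorrelation of the indicator of the `r × r` square, a positive
semidefinite Toeplitz form, and `exp` of a PSD kernel is PSD by the Schur product theorem) and is stable under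
imaginary temporal-coboundary perturbations (diagonal unitary congruences of `H`).  [folklore]
-/

set_option linter.dupNamespace false -- summit = problem name (single-conjunct summit), D-0017

namespace Summit.HubbardSuperconductivity.HubbardSuperconductivity.Theorems

open Matrix
open scoped ComplexOrder MatrixOrder

variable {n : Type*} [Fintype n] [DecidableEq n]

/-- If `S` is a Hermitian involution and `T` is `S`-pseudo-Hermitian (`Tᴴ = S T S`), then `S * T` is
Hermitian. [folklore] -/
theorem birKrein_isHermitian_mul {S T : Matrix n n ℂ} (hS : Sᴴ = S) (hSS : S * S = 1)
    (hT : Tᴴ = S * T * S) : (S * T).IsHermitian := by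
  show (S * T)ᴴ = S * T
  rw [conjTranspose_mul, hT, hS, Matrix.mul_assoc, Matrix.mul_assoc, hSS, Matrix.mul_one]

/-- `S`-pseudo-Hermiticity recovered from a Hermitian `S * T`: the two formulations are equivalent for a
Hermitian involution `S`. [folklore] -/
theorem birKrein_pseudoHerm_of_isHermitian_mul {S T : Matrix n n ℂ} (hS : Sᴴ = S) (hSS : S * S = 1)
    (hH : (S * T).IsHermitian) : Tᴴ = S * T * S := by
  have hT : T = S * (S * T) := by rw [← Matrix.mul_assoc, hSS, Matrix.one_mul]
  have h1 : Tᴴ = (S * T)ᴴ * S := by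
    conv_lhs => rw [hT]
    rw [conjTranspose_mul, hS]
  rw [h1, hH.eq]

/-- The conjugation identity behind the Krein argument: for `k ≥ 0`,
`(R S Rᴴ)^(k+1) = R (S Rᴴ R)^k S Rᴴ`. [folklore] -/
theorem birKrein_conj_pow_succ (R S : Matrix n n ℂ) (k : ℕ) :
    (R * S * Rᴴ) ^ (k + 1) = R * (S * (Rᴴ * R)) ^ k * S * Rᴴ := by
  induction k with
  | zero => simp [Matrix.mul_assoc]
  | succ k ih =>
    rw [pow_succ, ih, pow_succ]
    simp only [Matrix.mul_assoc]

/-- Cyclicity: `tr (S (Rᴴ R))^(k+1) = tr (R S Rᴴ)^(k+1)`. [folklore] -/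
theorem birKrein_trace_pow_eq (R S : Matrix n n ℂ) (k : ℕ) :
    ((S * (Rᴴ * R)) ^ (k + 1)).trace = ((R * S * Rᴴ) ^ (k + 1)).trace := by
  rw [birKrein_conj_pow_succ, pow_succ]
  calc ((S * (Rᴴ * R)) ^ k * (S * (Rᴴ * R))).trace
      = ((S * (Rᴴ * R)) ^ k * S * Rᴴ * R).trace := by simp only [Matrix.mul_assoc]
    _ = (R * ((S * (Rᴴ * R)) ^ k * S * Rᴴ)).trace := Matrix.trace_mul_comm _ _
    _ = (R * (S * (Rᴴ * R)) ^ k * S * Rᴴ).trace := by simp only [Matrix.mul_assoc]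

omit [DecidableEq n] in
/-- `R S Rᴴ` is Hermitian when `S` is. [folklore] -/
theorem birKrein_isHermitian_conj (R : Matrix n n ℂ) {S : Matrix n n ℂ} (hS : Sᴴ = S) :
    (R * S * Rᴴ).IsHermitian :=
  Matrix.isHermitian_mul_mul_conjTranspose R (show S.IsHermitian from hS)

/-- The trace of an even power of a Hermitian matrix is real and non-negative. [folklore] -/
theorem birKrein_trace_even_pow_nonneg_of_isHermitian {Y : Matrix n n ℂ} (hY : Y.IsHermitian) (m : ℕ) :
    0 ≤ (Y ^ (2 * m)).trace := by
  have h : Y ^ (2 * m) = (Y ^ m)ᴴ * Y ^ m := by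
    rw [conjTranspose_pow, hY.eq, ← pow_add, two_mul]
  rw [h]
  exact (Matrix.posSemidef_conjTranspose_mul_self _).trace_nonneg

/-- **Krein positivity of even traces (semidefinite form).**  If `S` is a Hermitian involution and the
Hermitian part `S * T` of the `S`-pseudo-Hermitian matrix `T` is positive semidefinite, then `tr T^(2m) ≥ 0`
(a real number) for every `m`. [folklore] -/
theorem birKrein_trace_even_pow_nonneg {S T : Matrix n n ℂ} (hS : Sᴴ = S) (hSS : S * S = 1)
    (hH : (S * T).PosSemidef) (m : ℕ) : 0 ≤ (T ^ (2 * m)).trace := by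
  rcases Nat.eq_zero_or_pos m with rfl | hm
  · simp only [Nat.mul_zero, pow_zero, Matrix.trace_one]
    exact Nat.cast_nonneg _
  -- the square root of `H = S T`
  set H := S * T with hHdef
  have hH0 : (0 : Matrix n n ℂ) ≤ H := Matrix.nonneg_iff_posSemidef.mpr hH
  set R := CFC.sqrt H with hR
  have hRR : R * R = H := CFC.sqrt_mul_sqrt_self H hH0
  have hR0 : (0 : Matrix n n ℂ) ≤ R := CFC.sqrt_nonneg H
  have hRh : R.IsHermitian := (Matrix.nonneg_iff_posSemidef.mp hR0).1
  have hT : T = S * (Rᴴ * R) := by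
    rw [hRh.eq, hRR, hHdef, ← Matrix.mul_assoc, hSS, Matrix.one_mul]
  obtain ⟨k, hk⟩ : ∃ k, 2 * m = k + 1 := ⟨2 * m - 1, by omega⟩
  rw [hT, hk, birKrein_trace_pow_eq, ← hk]
  exact birKrein_trace_even_pow_nonneg_of_isHermitian (birKrein_isHermitian_conj R hS) m

/-- Real-part / imaginary-part form of `birKrein_trace_even_pow_nonneg`. [folklore] -/
theorem birKrein_trace_even_pow_re_nonneg {S T : Matrix n n ℂ} (hS : Sᴴ = S) (hSS : S * S = 1)
    (hH : (S * T).PosSemidef) (m : ℕ) :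
    0 ≤ ((T ^ (2 * m)).trace).re ∧ ((T ^ (2 * m)).trace).im = 0 := by
  have h := birKrein_trace_even_pow_nonneg hS hSS hH m
  rw [Complex.nonneg_iff] at h
  exact ⟨h.1, h.2.symm⟩

/-- **Krein positivity of even traces (definite form).**  If `S` is a Hermitian involution and `S * T` is
positive DEFINITE, then `tr T^(2m) > 0` for every `m` (non-empty index type). [folklore] -/
theorem birKrein_trace_even_pow_pos [Nonempty n] {S T : Matrix n n ℂ} (hS : Sᴴ = S) (hSS : S * S = 1)
    (hH : (S * T).PosDef) (m : ℕ) : 0 < (T ^ (2 * m)).trace := by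
  rcases Nat.eq_zero_or_pos m with rfl | hm
  · simp only [Nat.mul_zero, pow_zero, Matrix.trace_one]
    exact_mod_cast Fintype.card_pos
  set H := S * T with hHdef
  have hH0 : (0 : Matrix n n ℂ) ≤ H := Matrix.nonneg_iff_posSemidef.mpr hH.posSemidef
  set R := CFC.sqrt H with hR
  have hRR : R * R = H := CFC.sqrt_mul_sqrt_self H hH0
  have hR0 : (0 : Matrix n n ℂ) ≤ R := CFC.sqrt_nonneg H
  have hRh : R.IsHermitian := (Matrix.nonneg_iff_posSemidef.mp hR0).1
  have hT : T = S * (Rᴴ * R) := by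
    rw [hRh.eq, hRR, hHdef, ← Matrix.mul_assoc, hSS, Matrix.one_mul]
  -- `R` and `S` have non-zero determinant, hence so does `Y = R S Rᴴ` and every power of it
  have hdetH : H.det ≠ 0 := hH.det_pos.ne'
  have hdetR : R.det ≠ 0 := by
    intro h0
    apply hdetH
    rw [← hRR, det_mul, h0, mul_zero]
  have hdetS : S.det ≠ 0 := by
    intro h0
    have : (S * S).det = 1 := by rw [hSS, det_one]
    rw [det_mul, h0, mul_zero] at this
    exact zero_ne_one this
  set Y := R * S * Rᴴ with hY
  have hYh : Y.IsHermitian := birKrein_isHermitian_conj R hS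
  have hdetY : Y.det ≠ 0 := by
    rw [hY, det_mul, det_mul, hRh.eq]
    exact mul_ne_zero (mul_ne_zero hdetR hdetS) hdetR
  have hdetYm : (Y ^ m).det ≠ 0 := by
    rw [det_pow]; exact pow_ne_zero _ hdetY
  have hinj : Function.Injective (Y ^ m).mulVec :=
    Matrix.mulVec_injective_iff_isUnit.mpr ((Matrix.isUnit_iff_isUnit_det _).mpr (Ne.isUnit hdetYm))
  have hpos : ((Y ^ m)ᴴ * Y ^ m).PosDef := Matrix.PosDef.conjTranspose_mul_self _ hinj
  have hYpow : Y ^ (2 * m) = (Y ^ m)ᴴ * Y ^ m := by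
    rw [conjTranspose_pow, hYh.eq, ← pow_add, two_mul]
  obtain ⟨k, hk⟩ : ∃ k, 2 * m = k + 1 := ⟨2 * m - 1, by omega⟩
  rw [hT, hk, birKrein_trace_pow_eq, ← hk, ← hY, hYpow]
  exact hpos.trace_pos

/-- The same with the hypothesis in pseudo-Hermitian form `Tᴴ = S T S` plus positivity of `S T`, and the
conclusion split into real and imaginary parts — the shape in which `Z = tr T^M` (even `M`) enters the engine
`BirComplexStableXYR` for the reflection-positive subclass of admissible tables. [folklore] -/
theorem birKrein_partitionTrace_pos : ∀ {ι : Type} [Fintype ι] [DecidableEq ι] [Nonempty ι] (S T : Matrix ι ι ℂ), Sᴴ = S → S * S = 1 → Tᴴ = S * T * S → (S * T).PosDef → ∀ (M : ℕ), Even M → 0 < ((T ^ M).trace).re ∧ ((T ^ M).trace).im = 0 := by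
  intro ι _ _ _ S T hS hSS _hT hH M hM
  obtain ⟨m, rfl⟩ := hM
  have h := birKrein_trace_even_pow_pos hS hSS hH m
  rw [← two_mul]
  rw [Complex.pos_iff] at h
  exact ⟨h.1, h.2.symm⟩

end Summit.HubbardSuperconductivity.HubbardSuperconductivity.Theorems
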